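import Mathlib
import HarnessLib
import Literature.Combinatorics.Additive.StepBeyondKempermanComplementExcluded
import Literature.Combinatorics.Additive.StepBeyondKempermanComplementProgressions
import Literature.Combinatorics.Additive.StepBeyondKempermanETransform

/-!
# Grynkiewicz 2009, §6 Subcase 2 (first two paragraphs): the transformed pair `(A(e), B(e))` has
# `|A(e) + B(e)| = |A(e)| + |B(e)|`, `A(e) + B(e) = e + A + B`, and is non-extendible

[cite: Grynkiewicz2009, §6 Subcase 2 (p. 31, ¶1–2), Subcase 4 (p. 32, ¶1)] [tag: critical-pair] [tag: inverse-theorem]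

Topic `Literature/Combinatorics/Additive`.  Cell `mm-stpp` (D-0046), seat `mm-stpp-lit` (gen 24); the
port of D. J. Grynkiewicz, *A step beyond Kemperman's structure theorem*, Mathematika **55** (2009)
67–114 continued.  In CASE I of §6, after Subcase 1 one may assume `A(e) + B(e)` aperiodic, and then
(56) `|A(e) + B(e)| ≥ |A(e)| + |B(e)| − 1` (Kneser) while (52) `A(e) + B(e) ⊆ e + A + B` and
`|A(e)| + |B(e)| = |A| + |B| = |A + B|`.  Subcase 2 begins (p. 31): «If `|A(e) + B(e)| = |A(e)| + |B(e)| − 1`,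
then since `A(e) + B(e)` is aperiodic, it follows in view of KST that … `A(e) + B(e)` is quasi-periodic or …
an arithmetic progression … Since `|A(e) + B(e)| = |A + B| − 1` … the quasi-period must be `G` (in view of
(46) and (49)) … contradicting … (49) or (51).  So we may assume `|A(e) + B(e)| = |A(e)| + |B(e)|`, whence
(52) implies that `A(e) + B(e) = A + B`.  Consequently, if `(A(e), B(e))` is extendible, then we can apply
the argument of the previous paragraph to the pair (extended by one element) and obtain the same
contradiction.  Therefore we may assume `(A(e), B(e))` is non-extendible»; Subcase 4 (p. 32) reuses the
first paragraph verbatim.  The KST step is the tree's `Grynkiewicz2009.false_of_critical_of_compl`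
(`StepBeyondKempermanComplementExcluded.lean`), applied with `W = e + \overline{A + B}`.

`Grynkiewicz2009.eTransform_card_add_eq_and_isNonExtendible` states the outcome for any `X ⊇ A`, `Y` with
`X + Y ⊆ e + (A + B)`, `|X| + |Y| = |A| + |B|`, `|Y| ≥ 2` and `X + Y` aperiodic (so it serves both
`|B(e)| ≥ 3` and `|B(e)| = 2`), under the standing data `0 ∈ A`, `⟨A⟩ = G`, `|A| ≥ 2`,
`|A + B| = |A| + |B|`, `|\overline{A + B}| ≥ 3`, (46), (49), (51).

Gen 25 addition (¶2–¶3 set-up): `Grynkiewicz2009.not_isQuasiPeriodic_and_closure_of_dual` (Lemma 5.4 on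
the dual pairs of Proposition 2.4: `A(e)`, `B(e)` are generating and not quasi-periodic) and
`Grynkiewicz2009.subcaseTwo_reduction` (the translated pair `(−y₀ + A(e), −y₀ + B(e))` with all the data
the induction hypothesis and `StepBeyondKempermanSubcaseTwo.lean` consume).

WHAT THIS FILE IS NOT: the contradiction of ¶3 itself is `StepBeyondKempermanSubcaseTwo.lean`; no new
definitions, no named facts.

## References
* D. J. Grynkiewicz, *A step beyond Kemperman's structure theorem*, Mathematika 55 (2009) 67–114,
  doi:10.1112/S0025579300000966; §6 Subcase 2 (p. 31), Subcase 4 (p. 32), displays (52), (56) (held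
  `paper:doi-10-1112-s0025579300000966`) [cite: Grynkiewicz2009, §6 Subcase 2].
-/

namespace Literature.Combinatorics.Additive

open Finset
open scoped Pointwise

universe u

variable {G : Type u} [AddCommGroup G] [DecidableEq G]

namespace Grynkiewicz2009

/-- `(e + S)ᶜ = e + Sᶜ`. [folklore] -/
private theorem compl_vadd_finset [Fintype G] (e : G) (S : Finset G) : (e +ᵥ S)ᶜ = e +ᵥ Sᶜ := by
  ext x
  rw [mem_compl, mem_vadd_finset, mem_vadd_finset]
  constructor
  · intro h
    refine ⟨-e + x, mem_compl.2 fun hx => h ⟨-e + x, hx, by rw [vadd_eq_add, add_neg_cancel_left]⟩, ?_⟩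
    rw [vadd_eq_add, add_neg_cancel_left]
  · rintro ⟨s, hs, rfl⟩ ⟨t, ht, hts⟩
    rw [vadd_eq_add, vadd_eq_add, add_right_inj] at hts
    rw [hts] at ht
    exact mem_compl.1 hs ht

/-- **Subcase 2, ¶1: a critical aperiodic pair just below `e + A + B` is impossible.**  Under the standing
data for `(A, B)` (`0 ∈ A`, `⟨A⟩ = G`, `|A| ≥ 2`, `|\overline{A+B}| ≥ 3`, (46), (49), (51)), there is no
pair `X ⊇ A`, `Y` with `|Y| ≥ 2`, `X + Y ⊆ e + A + B` missing at most one element of it,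
`|X + Y| = |X| + |Y| − 1` and `X + Y` aperiodic («the quasi-period must be `G` (in view of (46) and (49))
… contradicting … (49) or (51)»). [cite: Grynkiewicz2009, §6 Subcase 2 (p. 31, ¶1)] -/
theorem false_of_critical_below_vadd_add [Fintype G] {A B X Y : Finset G} {e : G}
    (h0A : (0 : G) ∈ A) (hgenA : AddSubgroup.closure (A : Set G) = ⊤) (hA2 : 2 ≤ #A)
    (hC3 : 3 ≤ #(A + B)ᶜ)
    (h46 : ∀ γ ∈ (A + B)ᶜ, AddSubgroup.closure (((-γ) +ᵥ (A + B)ᶜ : Finset G) : Set G) = ⊤)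
    (h49 : 2 ≤ subsetDist (A + B)ᶜ {P | IsQuasiPeriodic P})
    (h51 : ∀ d : G, d ≠ 0 → 2 ≤ subsetDist (A + B)ᶜ {P | IsQuasiProgression d P})
    (hAX : A ⊆ X) (hY2 : 2 ≤ #Y) (hXY : X + Y ⊆ e +ᵥ (A + B)) (h1 : #(A + B) ≤ #(X + Y) + 1)
    (hcrit : #(X + Y) + 1 = #X + #Y) (haper : (X + Y).addStab = {0}) : False := by
  set W := e +ᵥ (A + B)ᶜ with hW
  obtain ⟨γ, hγ⟩ : ((A + B)ᶜ).Nonempty := card_pos.1 (by omega)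
  have hw₀ : e + γ ∈ W := mem_vadd_finset.2 ⟨γ, hγ, rfl⟩
  have hgenW : AddSubgroup.closure (((-(e + γ)) +ᵥ W : Finset G) : Set G) = ⊤ := by
    rw [hW, vadd_vadd, show -(e + γ) + e = -γ by abel]
    exact h46 γ hγ
  have h49W : 2 ≤ subsetDist W {P | IsQuasiPeriodic P} := by
    rw [hW, subsetDist_vadd_eq e (fun P => isQuasiPeriodic_vadd_iff e)]; exact h49
  have h51W : ∀ d : G, d ≠ 0 → 2 ≤ subsetDist W {P | IsQuasiProgression d P} := fun d hd => by
    rw [hW, subsetDist_vadd_eq e (fun P => isQuasiProgression_vadd_iff)]; exact h51 d hd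
  have hWc : W = (e +ᵥ (A + B))ᶜ := by rw [hW, compl_vadd_finset]
  have hWsub : W ⊆ (X + Y)ᶜ := by
    rw [hWc]; exact compl_subset_compl.2 hXY
  have hdiff : #((X + Y)ᶜ \ W) ≤ 1 := by
    have e1 : (X + Y)ᶜ \ W = (e +ᵥ (A + B)) \ (X + Y) := by
      ext x
      rw [hWc, mem_sdiff, mem_sdiff, mem_compl, mem_compl, not_not, and_comm]
    rw [e1, card_sdiff_of_subset hXY, card_vadd_finset]
    omega
  have hgenX : AddSubgroup.closure (X : Set G) = ⊤ :=
    top_le_iff.1 (hgenA ▸ AddSubgroup.closure_mono (coe_subset.2 hAX))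
  exact false_of_critical_of_compl (hAX h0A) hgenX ((card_le_card hAX).trans' hA2) hY2 hcrit haper hWsub
    hdiff ((card_vadd_finset e (A + B)ᶜ).symm ▸ (by omega)) hw₀ hgenW h49W h51W

/-- **Subcase 2, ¶1–2.**  Let `X ⊇ A` and `Y` with `|Y| ≥ 2`, `X + Y ⊆ e + A + B`,
`|X| + |Y| = |A| + |B| = |A + B|` and `X + Y` aperiodic (for instance `X = A(e) = (e + B) ∪ A`,
`Y = B(e) = (e + B) ∩ A`, by (52) and `|A(e)| + |B(e)| = |A| + |B|`).  Then, under the standing data for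
`(A, B)`, `|X + Y| = |X| + |Y|`, `X + Y = e + A + B`, and `(X, Y)` is non-extendible (both ways).
[cite: Grynkiewicz2009, §6 Subcase 2 (p. 31, ¶1–2), displays (52), (56)] -/
theorem eTransform_card_add_eq_and_isNonExtendible [Fintype G] {A B X Y : Finset G} {e : G}
    (h0A : (0 : G) ∈ A) (hgenA : AddSubgroup.closure (A : Set G) = ⊤) (hA2 : 2 ≤ #A)
    (hAB : #(A + B) = #A + #B) (hC3 : 3 ≤ #(A + B)ᶜ)
    (h46 : ∀ γ ∈ (A + B)ᶜ, AddSubgroup.closure (((-γ) +ᵥ (A + B)ᶜ : Finset G) : Set G) = ⊤)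
    (h49 : 2 ≤ subsetDist (A + B)ᶜ {P | IsQuasiPeriodic P})
    (h51 : ∀ d : G, d ≠ 0 → 2 ≤ subsetDist (A + B)ᶜ {P | IsQuasiProgression d P})
    (hAX : A ⊆ X) (hXY : X + Y ⊆ e +ᵥ (A + B)) (hcard : #X + #Y = #A + #B) (hY2 : 2 ≤ #Y)
    (haper : (X + Y).addStab = {0}) :
    #(X + Y) = #X + #Y ∧ X + Y = e +ᵥ (A + B) ∧ IsNonExtendible X Y ∧ IsNonExtendible Y X := by
  have hXne : X.Nonempty := ⟨0, hAX h0A⟩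
  have hYne : Y.Nonempty := card_pos.1 (by omega)
  -- Kneser (56) and (52)
  have hkn := add_kneser X Y
  rw [haper, card_singleton] at hkn
  simp only [singleton_zero, add_zero] at hkn
  have hup : #(X + Y) ≤ #A + #B := by
    have := card_le_card hXY; rwa [card_vadd_finset, hAB] at this
  -- ¶1: `|X + Y| = |X| + |Y| − 1` is impossible
  have heq : #(X + Y) = #X + #Y := by
    by_contra hne
    exact false_of_critical_below_vadd_add h0A hgenA hA2 hC3 h46 h49 h51 hAX hY2 hXY (by omega)
      (by omega) haper
  have hsum : X + Y = e +ᵥ (A + B) :=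
    eq_of_subset_of_card_le hXY (by rw [card_vadd_finset, hAB, heq, hcard])
  refine ⟨heq, hsum, ?_, ?_⟩
  · -- ¶2: an extension of `X` would give a critical pair with the same sumset
    intro x hx hext
    have hAX' : A ⊆ insert x X := hAX.trans (subset_insert x X)
    refine false_of_critical_below_vadd_add h0A hgenA hA2 hC3 h46 h49 h51 hAX' hY2
      (by rw [hext]; exact hXY) (by rw [hext]; omega) ?_ (by rw [hext]; exact haper)
    rw [hext, card_insert_of_notMem hx]; omega
  · intro y hy hext
    rw [add_comm, add_comm Y] at hext
    refine false_of_critical_below_vadd_add h0A hgenA hA2 hC3 h46 h49 h51 hAX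
      ((card_le_card (subset_insert y Y)).trans' hY2) (by rw [hext]; exact hXY) (by rw [hext]; omega)
      ?_ (by rw [hext]; exact haper)
    rw [hext, card_insert_of_notMem hy]; omega

/-! ### Subcase 2, ¶2–3 set-up: the translated pair `(A(e), B(e))` and Lemma 5.4 -/

/-- `(g + A) + (g′ + B) = (g + g′) + (A + B)`. [folklore] -/
private theorem vadd_add_vadd_sc2 (A B : Finset G) (g g' : G) :
    (g +ᵥ A) + (g' +ᵥ B) = (g + g') +ᵥ (A + B) := by
  rw [vadd_add_assoc, add_comm A (g' +ᵥ B), vadd_add_assoc, vadd_vadd, add_comm B A]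

/-- `y₀ + (−S) = −((−y₀) + S)`. [folklore] -/
private theorem vadd_neg_eq_neg_vadd (y₀ : G) (S : Finset G) : y₀ +ᵥ (-S) = -((-y₀) +ᵥ S) := by
  ext z
  simp only [mem_vadd_finset, mem_neg', vadd_eq_add]
  constructor
  · rintro ⟨s, hs, rfl⟩
    exact ⟨-s, hs, by abel⟩
  · rintro ⟨s, hs, h⟩
    refine ⟨-s, by rwa [neg_neg], ?_⟩
    have : z = -(-y₀ + s) := by rw [h, neg_neg]
    rw [this]; abel

/-- **Lemma 5.4 for the dual pairs of a non-extendible pair** (the step «Thus Lemma 5.4—which we can apply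
to `(−γ + \overline{A + B}, −B(e))` and `(−γ + \overline{A + B}, −A(e))` … in view of Proposition 2.4 …—
implies that `A(e)` and `B(e)` are both non-quasi-periodic, generating subsets», print p. 31).  Let
`(X₀, Y₀)` be non-extendible with `|X₀ + Y₀| = |X₀| + |Y₀|`, `X₀ + Y₀` aperiodic, `|X₀|, |Y₀| ≥ 3`,
`|\overline{X₀ + Y₀}| ≥ 3`, `y₀ ∈ Y₀ ⊆ X₀`; suppose some translate `P = −c + \overline{X₀ + Y₀}` contains
`0`, generates `G` and is not quasi-periodic.  Then `−y₀ + Y₀` and `−y₀ + X₀` generate `G` and are not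
quasi-periodic. [cite: Grynkiewicz2009, §6 Subcase 2 (p. 31, ¶3); Lemma 5.4; Prop 2.4] -/
theorem not_isQuasiPeriodic_and_closure_of_dual [Fintype G] {X₀ Y₀ : Finset G} {c y₀ : G}
    (hX3 : 3 ≤ #X₀) (hY3 : 3 ≤ #Y₀) (hXY : #(X₀ + Y₀) = #X₀ + #Y₀)
    (haper : (X₀ + Y₀).addStab = {0}) (hneX : IsNonExtendible X₀ Y₀) (hneY : IsNonExtendible Y₀ X₀)
    (hC3 : 3 ≤ #(X₀ + Y₀)ᶜ) (hc : c ∈ (X₀ + Y₀)ᶜ)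
    (hgenP : AddSubgroup.closure (((-c) +ᵥ (X₀ + Y₀)ᶜ : Finset G) : Set G) = ⊤)
    (hPqp : ¬ IsQuasiPeriodic ((-c) +ᵥ (X₀ + Y₀)ᶜ))
    (hy₀ : y₀ ∈ Y₀) (hy₀X : y₀ ∈ X₀) :
    (AddSubgroup.closure (((-y₀) +ᵥ Y₀ : Finset G) : Set G) = ⊤ ∧ ¬ IsQuasiPeriodic ((-y₀) +ᵥ Y₀)) ∧
      (AddSubgroup.closure (((-y₀) +ᵥ X₀ : Finset G) : Set G) = ⊤ ∧ ¬ IsQuasiPeriodic ((-y₀) +ᵥ X₀)) := by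
  set P : Finset G := (-c) +ᵥ (X₀ + Y₀)ᶜ with hPdef
  have hX₀ne : X₀.Nonempty := card_pos.1 (by omega)
  have hY₀ne : Y₀.Nonempty := card_pos.1 (by omega)
  have h0P : (0 : G) ∈ P := mem_vadd_finset.2 ⟨c, hc, by rw [vadd_eq_add, neg_add_cancel]⟩
  have hP3 : 3 ≤ #P := by rw [hPdef, card_vadd_finset]; exact hC3
  have hM : #(X₀ + Y₀) + #(X₀ + Y₀)ᶜ = Fintype.card G := by
    rw [card_compl]; have := card_le_univ (X₀ + Y₀); omega
  -- aperiodicity of `X₀`, `Y₀` and of their complements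
  have hstX₀ : X₀.addStab = {0} := by
    refine Subset.antisymm ?_ (singleton_subset_iff.2 hX₀ne.zero_mem_addStab)
    rw [← haper]; exact subset_addStab_add_left hY₀ne
  have hstY₀ : Y₀.addStab = {0} := by
    refine Subset.antisymm ?_ (singleton_subset_iff.2 hY₀ne.zero_mem_addStab)
    rw [← haper]; exact subset_addStab_add_right hX₀ne
  have hXc : #X₀ᶜ = Fintype.card G - #X₀ := card_compl _
  have hYc : #Y₀ᶜ = Fintype.card G - #Y₀ := card_compl _
  have hX₀cne : (X₀ᶜ : Finset G).Nonempty := card_pos.1 (by omega)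
  have hY₀cne : (Y₀ᶜ : Finset G).Nonempty := card_pos.1 (by omega)
  -- the generic Lemma 5.4 step for a dual pair `(P, y₀ − Z)`
  have key : ∀ {Z W : Finset G}, 3 ≤ #Z → y₀ ∈ Z → -Z + (X₀ + Y₀)ᶜ = Wᶜ → W.Nonempty →
      (Wᶜ : Finset G).Nonempty → W.addStab = {0} → #Wᶜ = #(X₀ + Y₀)ᶜ + #Z →
      IsNonExtendible (-Z) (X₀ + Y₀)ᶜ → IsNonExtendible (X₀ + Y₀)ᶜ (-Z) →
      AddSubgroup.closure (((-y₀) +ᵥ Z : Finset G) : Set G) = ⊤ ∧ ¬ IsQuasiPeriodic ((-y₀) +ᵥ Z) := by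
    intro Z W hZ3 hy₀Z hsumW hWne hWcne hstW hcardW hne1 hne2
    set Q : Finset G := y₀ +ᵥ (-Z) with hQdef
    have h0Q : (0 : G) ∈ Q := mem_vadd_finset.2 ⟨-y₀, by rw [mem_neg', neg_neg]; exact hy₀Z,
      by rw [vadd_eq_add, add_neg_cancel]⟩
    have hQ3 : 3 ≤ #Q := by rw [hQdef, card_vadd_finset, card_neg]; exact hZ3
    have hPQ : P + Q = (-c + y₀) +ᵥ Wᶜ := by
      rw [hPdef, hQdef, vadd_add_vadd_sc2, add_comm ((X₀ + Y₀)ᶜ) (-Z), hsumW]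
    have hcPQ : #(P + Q) = #P + #Q := by
      rw [hPQ, card_vadd_finset, hcardW, hPdef, hQdef, card_vadd_finset, card_vadd_finset, card_neg]
    have haperPQ : (P + Q).addStab = {0} := by
      rw [hPQ, addStab_vadd, addStab_compl hWne hWcne, hstW]
    have hnePQ : IsNonExtendible P Q := by
      rw [hPdef, hQdef]; exact (hne2.vadd_left (-c)).vadd_right y₀
    have hneQP : IsNonExtendible Q P := by
      rw [hPdef, hQdef]; exact (hne1.vadd_left y₀).vadd_right (-c)
    obtain ⟨hQqp, hgenQ⟩ :=
      not_isQuasiPeriodic_and_closure_eq_top hP3 hQ3 h0P h0Q hcPQ haperPQ hnePQ hneQP hgenP hPqp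
    have hQeq : Q = -((-y₀) +ᵥ Z) := by rw [hQdef, vadd_neg_eq_neg_vadd]
    refine ⟨?_, ?_⟩
    · rw [hQeq, coe_neg, AddSubgroup.closure_neg] at hgenQ; exact hgenQ
    · rw [hQeq, isQuasiPeriodic_neg_iff] at hQqp; exact hQqp
  obtain ⟨hsum1, hne1a, hne1b⟩ := isNonExtendible_pair_neg_compl' hneX hneY
  obtain ⟨hsum2, hne2a, hne2b⟩ := isNonExtendible_pair_neg_compl hneX hneY
  refine ⟨key hY3 hy₀ hsum1 hX₀ne hX₀cne hstX₀ (by omega) hne1a hne1b,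
    key hX3 hy₀X hsum2 hY₀ne hY₀cne hstY₀ (by omega) hne2a hne2b⟩

/-- **Subcase 2, ¶2–¶3 set-up** (print p. 31): «So we can assume `(A(e), B(e))` is non-extendible.  Thus
Lemma 5.4 … implies that `A(e)` and `B(e)` are both non-quasi-periodic, generating subsets, whence the
theorem holds for `A(e)` and `B(e)` by induction hypothesis».  Packaged for the induction: from the
standing data for `(A, B)` (`0 ∈ A ∩ B`, `|A| ≥ 3`, `|A + B| = |A| + |B|` aperiodic, `(A, B)` non-extendible,
`⟨A⟩ = G`, `A` not quasi-periodic, `|\overline{A + B}| ≥ 3`, Claim 5, (49), (51)) and an `e` with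
`|B(e)| ≥ 3` and `A(e) + B(e)` aperiodic, the translates `X = −y₀ + A(e)`, `Y = −y₀ + B(e)` (`y₀ ∈ B(e)`)
contain `0`, have `|X| = |A(e)|`, `|Y| = |B(e)|`, `|X + Y| = |X| + |Y|`, inherit Claim 5, (49), (51) and
`|\overline{X + Y}| = |\overline{A + B}|`, are non-extendible (¶1–2), and are both generating and not
quasi-periodic (Lemma 5.4 on the dual pairs, `not_isQuasiPeriodic_and_closure_of_dual`; (45), (46) from
`not_isQuasiPeriodic_add_and_compl`). [cite: Grynkiewicz2009, §6 Subcase 2 (p. 31, ¶2–3)] -/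
theorem subcaseTwo_reduction [Fintype G] {A B : Finset G} {e : G}
    (h0A : (0 : G) ∈ A) (h0B : (0 : G) ∈ B) (hA3 : 3 ≤ #A) (hAB : #(A + B) = #A + #B)
    (haperAB : (A + B).addStab = {0})
    (hP3 : ∀ P : Finset G, A + B ⊆ P → P.addStab ≠ {0} → 3 ≤ #(P \ (A + B)))
    (hneA : IsNonExtendible A B) (hneB : IsNonExtendible B A)
    (hgenA : AddSubgroup.closure (A : Set G) = ⊤) (hAqp : ¬ IsQuasiPeriodic A)
    (hC3 : 3 ≤ #(A + B)ᶜ)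
    (h49 : 2 ≤ subsetDist (A + B)ᶜ {P | IsQuasiPeriodic P})
    (h51 : ∀ d : G, d ≠ 0 → 2 ≤ subsetDist (A + B)ᶜ {P | IsQuasiProgression d P})
    (hY3 : 3 ≤ #((e +ᵥ B) ∩ A))
    (haper : (((e +ᵥ B) ∪ A) + ((e +ᵥ B) ∩ A)).addStab = {0}) :
    ∃ X Y : Finset G, (0 : G) ∈ X ∧ (0 : G) ∈ Y ∧ #X = #((e +ᵥ B) ∪ A) ∧ #Y = #((e +ᵥ B) ∩ A) ∧
      #(X + Y) = #X + #Y ∧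
      (∀ P : Finset G, X + Y ⊆ P → P.addStab ≠ {0} → 3 ≤ #(P \ (X + Y))) ∧
      IsNonExtendible X Y ∧ IsNonExtendible Y X ∧
      AddSubgroup.closure (X : Set G) = ⊤ ∧ ¬ IsQuasiPeriodic X ∧
      AddSubgroup.closure (Y : Set G) = ⊤ ∧ ¬ IsQuasiPeriodic Y ∧
      #(X + Y)ᶜ = #(A + B)ᶜ ∧ 2 ≤ subsetDist (X + Y)ᶜ {P | IsQuasiPeriodic P} ∧
      (∀ d : G, d ≠ 0 → 2 ≤ subsetDist (X + Y)ᶜ {P | IsQuasiProgression d P}) := by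
  set X₀ : Finset G := (e +ᵥ B) ∪ A with hX₀
  set Y₀ : Finset G := (e +ᵥ B) ∩ A with hY₀
  -- (45), (46) for `\overline{A + B}` (Lemma 5.4)
  obtain ⟨-, h45c, h46⟩ :=
    not_isQuasiPeriodic_add_and_compl hA3 hC3 h0A h0B hAB haperAB hneA hneB hgenA hAqp
  -- ¶1–2
  obtain ⟨hXY₀, hsum₀, hneX₀, hneY₀⟩ :=
    eTransform_card_add_eq_and_isNonExtendible (X := X₀) (Y := Y₀) h0A hgenA (by omega) hAB hC3 h46
      h49 h51 (by rw [hX₀]; exact subset_union_right) (eTransform_add_subset A B e)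
      (card_eTransform A B e) (by omega) haper
  have hY₀ne : Y₀.Nonempty := card_pos.1 (by omega)
  obtain ⟨y₀, hy₀⟩ := id hY₀ne
  have hy₀X : y₀ ∈ X₀ := by
    have h := hy₀
    rw [hY₀, mem_inter] at h
    rw [hX₀]; exact mem_union_left _ h.1
  have hX₀3 : 3 ≤ #X₀ := hA3.trans (card_le_card (by rw [hX₀]; exact subset_union_right))
  have hcXY₀ : #(X₀ + Y₀) = #(A + B) := by rw [hsum₀, card_vadd_finset]
  have hC₀eq : (X₀ + Y₀)ᶜ = e +ᵥ (A + B)ᶜ := by rw [hsum₀, compl_vadd_finset]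
  have hcC₀ : #(X₀ + Y₀)ᶜ = #(A + B)ᶜ := by rw [hC₀eq, card_vadd_finset]
  -- Lemma 5.4 on the dual pairs, with `P = −γ + \overline{A + B}`
  obtain ⟨γ, hγ⟩ : ((A + B)ᶜ).Nonempty := card_pos.1 (by omega)
  have hc : e + γ ∈ (X₀ + Y₀)ᶜ := by rw [hC₀eq]; exact mem_vadd_finset.2 ⟨γ, hγ, rfl⟩
  have hPeq : (-(e + γ)) +ᵥ (X₀ + Y₀)ᶜ = (-γ) +ᵥ (A + B)ᶜ := by
    rw [hC₀eq, vadd_vadd]; congr 1; abel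
  have hgenP : AddSubgroup.closure (((-(e + γ)) +ᵥ (X₀ + Y₀)ᶜ : Finset G) : Set G) = ⊤ := by
    rw [hPeq]; exact h46 γ hγ
  have hPqp : ¬ IsQuasiPeriodic ((-(e + γ)) +ᵥ (X₀ + Y₀)ᶜ) := by
    rw [hPeq, isQuasiPeriodic_vadd_iff]; exact h45c
  obtain ⟨⟨hgenY, hYqp⟩, ⟨hgenX, hXqp⟩⟩ :=
    not_isQuasiPeriodic_and_closure_of_dual hX₀3 hY3 hXY₀ haper hneX₀ hneY₀ (by omega) hc hgenP hPqp
      hy₀ hy₀X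
  -- the translated pair
  set X : Finset G := (-y₀) +ᵥ X₀ with hXdef
  set Y : Finset G := (-y₀) +ᵥ Y₀ with hYdef
  have hXYsum : X + Y = (-y₀ + -y₀ + e) +ᵥ (A + B) := by
    rw [hXdef, hYdef, vadd_add_vadd_sc2, hsum₀, vadd_vadd]
  have hcX : #X = #X₀ := card_vadd_finset _ _
  have hcY : #Y = #Y₀ := card_vadd_finset _ _
  have hcXY : #(X + Y) = #X + #Y := by
    rw [hXYsum, card_vadd_finset, hcX, hcY, ← hcXY₀, hsum₀, card_vadd_finset]; exact hXY₀ ▸ hcXY₀ ▸ rfl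
  have hCeq : (X + Y)ᶜ = (-y₀ + -y₀ + e) +ᵥ (A + B)ᶜ := by rw [hXYsum, compl_vadd_finset]
  refine ⟨X, Y, ?_, ?_, hcX, hcY, hcXY, ?_, ?_, ?_, hgenX, hXqp, hgenY, hYqp, ?_, ?_, ?_⟩
  · exact mem_vadd_finset.2 ⟨y₀, hy₀X, by rw [vadd_eq_add, neg_add_cancel]⟩
  · exact mem_vadd_finset.2 ⟨y₀, hy₀, by rw [vadd_eq_add, neg_add_cancel]⟩
  · rw [hXYsum]; exact forall_card_sdiff_vadd _ hP3
  · rw [hXdef, hYdef]; exact (hneX₀.vadd_left (-y₀)).vadd_right (-y₀)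
  · rw [hXdef, hYdef]; exact (hneY₀.vadd_left (-y₀)).vadd_right (-y₀)
  · rw [hCeq, card_vadd_finset]
  · rw [hCeq, subsetDist_vadd_eq _ (fun P => isQuasiPeriodic_vadd_iff _)]; exact h49
  · intro d hd
    rw [hCeq, subsetDist_vadd_eq _ (fun P => isQuasiProgression_vadd_iff)]; exact h51 d hd

end Grynkiewicz2009

end Literature.Combinatorics.Additive
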